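import Summits.AtomisticToContinuum.BoseEinsteinCondensation.Theorems.PuffFloor.Negative.SmoothClassInhabitants
import Summits.AtomisticToContinuum.BoseEinsteinCondensation.Theorems.BECPhaseQuadratureSumRuleSumRuleChainGlueEnergy
import Literature.MathematicalPhysics.QuantumManyBody.BoseGasThermodynamicLimitRuelle
import HarnessLib

/-!
# An explicit smooth-class tower increasing to the hard core
# (worker stub W-B `stub_smoothTowerHardCore`, line `near-minimiser-slack-transfer`,
# crux `BECConjugateDomination.HardCoreExtension`, stmt-AtomisticToContinuum-11786)

The line proves hard-sphere BEC by transferring near-minimiser condensation along a monotone tower of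
pointwise minorants `w t ↑ hardCorePotential a` at fixed volume. This file supplies the explicit tower of
SMOOTH-CLASS potentials (the route's currency: repulsive finite range, finite, `C²` as `x ↦ w(|x|)` on `ℝ³`,
edge condition `‖D²w̃‖ ≤ Cₑ √w̃`, range `≤ a`):

  `w t r = t · solidBump a r = t · e^{-1/(a² - r²)}` for `0 ≤ r` (`= 0` for `r ≥ a`),   `w t r = t` for `r < 0`.

The patch on the negative half-line is invisible to `x ↦ w t |x|` (`|x| ≥ 0`) and is only there because
the pointwise supremum is required on all of `ℝ`, where `hardCorePotential a r = ⊤` for every `r < a`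
(negative `r` included) while the even profile `solidBump a` vanishes for `r ≤ -a`. The four smooth-class
clauses are `smoothClass_smul` (closure of the class under `v ↦ t·v`, `0 ≤ t`) applied to
`solidBump_mem_smoothClass`; monotonicity in `t` is `t ≤ t + 1`; the supremum is `⨆ t, t·c = ⊤` for the
positive core value `c = solidBump a r`, `0 ≤ r < a` (resp. `⨆ t, t = ⊤` for `r < 0`) and `0` beyond `a`.

All `[folklore]`; no Theses statement is asserted.
-/

noncomputable section

namespace Summit.AtomisticToContinuum.BoseEinsteinCondensation.Cruxes.HardCoreExtension.NearMinTower

open MeasureTheory Filter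
open scoped ENNReal NNReal Topology
open Literature.MathematicalPhysics.QuantumManyBody.BoseGas
open Summit.AtomisticToContinuum.BoseEinsteinCondensation.Theorems.PuffFloor.Negative
open Summit.AtomisticToContinuum.BoseEinsteinCondensation.Theorems.SumRuleChainGlue

/-- Beyond its range the solid bump vanishes: `solidBump a r = 0` for `0 < a ≤ r`. [folklore] -/
theorem solidBump_eq_zero_of_le {a r : ℝ} (ha : 0 < a) (h : a ≤ r) : solidBump a r = 0 := by
  simp only [solidBump, glueProfile, ENNReal.ofReal_eq_zero]
  refine le_of_eq (expNegInvGlue.zero_of_nonpos ?_)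
  nlinarith

/-- Inside the core the solid bump is positive: `solidBump a r ≠ 0` for `0 ≤ r < a`. [folklore] -/
theorem solidBump_ne_zero_of_lt {a r : ℝ} (h0 : 0 ≤ r) (h : r < a) : solidBump a r ≠ 0 := by
  simp only [solidBump, glueProfile, ne_eq, ENNReal.ofReal_eq_zero, not_le]
  refine expNegInvGlue.pos_of_pos ?_
  nlinarith

/-- `⨆ t : ℕ, t · c = ⊤` in `ℝ≥0∞` for `c ≠ 0`. [folklore] -/
theorem iSup_natCast_mul_eq_top {c : ℝ≥0∞} (hc : c ≠ 0) : ⨆ t : ℕ, (t : ℝ≥0∞) * c = ⊤ := by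
  rw [← ENNReal.iSup_mul, ENNReal.iSup_natCast, ENNReal.top_mul hc]

/-- **W-B: an explicit smooth-class tower increasing to the hard core.** For every `a > 0` there is a
tower `w : ℕ → ℝ → ℝ≥0∞` of smooth-class potentials (repulsive finite range, finite, `C²` as `x ↦ w t |x|`
on `ℝ³`, edge condition `‖D² w̃‖ ≤ Cₑ √w̃`) of range `≤ a`, pointwise non-decreasing in `t`, with
`⨆ t, w t r = hardCorePotential a r` for every real `r`; namely `w t r = t · e^{-1/(a² - r²)}` for
`0 ≤ r < a`, `0` for `r ≥ a`, and `t` for `r < 0`. [folklore] -/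
theorem stub_smoothTowerHardCore :
    ∀ a : ℝ, 0 < a → ∃ w : ℕ → ℝ → ℝ≥0∞,
      (∀ t, IsRepulsiveFiniteRange (w t) ∧ (∀ r, w t r ≠ ⊤) ∧
        ContDiff ℝ 2 (fun x : Space => (w t ‖x‖).toReal) ∧
        (∃ Cₑ : ℝ, ∀ x : Space,
          ‖iteratedFDeriv ℝ 2 (fun x : Space => (w t ‖x‖).toReal) x‖ ≤ Cₑ * Real.sqrt ((w t ‖x‖).toReal)) ∧
        (∀ r, a < r → w t r = 0)) ∧
      (∀ t r, w t r ≤ w (t + 1) r) ∧ (∀ r, ⨆ t, w t r = hardCorePotential a r) := by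
  intro a ha
  obtain ⟨hb1, hb2, hb3, hb4, -, -⟩ := solidBump_mem_smoothClass ha
  obtain ⟨w, hw⟩ : ∃ w : ℕ → ℝ → ℝ≥0∞, ∀ t r,
      w t r = if r < 0 then (t : ℝ≥0∞) else ENNReal.ofReal (t : ℝ) * solidBump a r :=
    ⟨fun t r => if r < 0 then (t : ℝ≥0∞) else ENNReal.ofReal (t : ℝ) * solidBump a r, fun _ _ => rfl⟩
  -- on the non-negative half-line (hence on `|x|`, `x ∈ ℝ³`) the tower is `t · solidBump a`
  have hnn : ∀ t (r : ℝ), 0 ≤ r → w t r = ENNReal.ofReal (t : ℝ) * solidBump a r := fun t r hr => by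
    rw [hw, if_neg (not_lt.2 hr)]
  have hfun : ∀ t : ℕ, (fun x : Space => (w t ‖x‖).toReal) =
      fun x : Space => ((fun r => ENNReal.ofReal (t : ℝ) * solidBump a r) ‖x‖).toReal := fun t =>
    funext fun x => by rw [hnn t ‖x‖ (norm_nonneg x)]
  -- range `a`
  have hzero : ∀ t r, a < r → w t r = 0 := fun t r hr => by
    rw [hnn t r (ha.le.trans hr.le), solidBump_eq_zero_of_le ha hr.le, mul_zero]
  refine ⟨w, fun t => ?_, fun t r => ?_, fun r => ?_⟩
  · -- level `t` is a smooth-class member of range `a`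
    have ht : (0 : ℝ) ≤ (t : ℝ) := Nat.cast_nonneg t
    obtain ⟨hs1, hs2, hs3, hs4⟩ := smoothClass_smul hb1 hb2 hb3 hb4 ht
    refine ⟨⟨?_, a, hzero t⟩, fun r => ?_, ?_, ?_, hzero t⟩
    · rw [show w t = fun r => if r < 0 then (t : ℝ≥0∞) else ENNReal.ofReal (t : ℝ) * solidBump a r from
        funext (hw t)]
      exact Measurable.ite measurableSet_Iio measurable_const hs1.1
    · rw [hw]
      split_ifs
      exacts [ENNReal.natCast_ne_top t, hs2 r]
    · rw [hfun t]
      exact hs3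
    · obtain ⟨Cₑ, hC⟩ := hs4
      refine ⟨Cₑ, fun x => ?_⟩
      rw [hfun t, hnn t ‖x‖ (norm_nonneg x)]
      exact hC x
  · -- monotone in the level
    rw [hw, hw]
    split_ifs
    · exact_mod_cast Nat.le_succ t
    · exact mul_le_mul_left (ENNReal.ofReal_le_ofReal (by exact_mod_cast Nat.le_succ t)) _
  · -- pointwise supremum = hard core
    simp only [hw]
    rcases lt_or_ge r 0 with hr | hr
    · simp only [if_pos hr]
      rw [ENNReal.iSup_natCast, hardCorePotential_of_lt (hr.trans ha)]
    · simp only [if_neg (not_lt.2 hr), ENNReal.ofReal_natCast]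
      rcases lt_or_ge r a with hra | hra
      · rw [iSup_natCast_mul_eq_top (solidBump_ne_zero_of_lt hr hra), hardCorePotential_of_lt hra]
      · simp only [solidBump_eq_zero_of_le ha hra, mul_zero, ENNReal.iSup_zero, hardCorePotential_of_le hra]

end Summit.AtomisticToContinuum.BoseEinsteinCondensation.Cruxes.HardCoreExtension.NearMinTower

end
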